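import Summits.CriticalPhenomena.PercolationContinuityZ3.Theorems.SahiMasterFamilyComplementForm
import Summits.CriticalPhenomena.PercolationContinuityZ3.Theorems.SahiMasterFamilyTransportMatching
import Summits.CriticalPhenomena.PercolationContinuityZ3.Theorems.SahiMasterFamilyUCBernsteinNestedLayers

/-!
# The COUNTING MODEL of conjecture (B) in the kernel: the Bernstein coefficients of the edge polynomial of ANY pair of families are
# `#(pointed all-bad configurations) − #(all-bad configurations)`, layer by layer; hence (TM) ⇒ (B), every order

Unit `prim-masterthm-p4` (gen 27; crux anchor stmt-CriticalPhenomena-4575, helper work; memo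
`run/shared/lean/prim/prim-masterthm/prim-masterthm-p4/P4-GEN27-REPORT.md` §1).  Companion of `…ComplementForm` (`Φ = Σ_z W^{(z)} − A`,
every real set function) and `…TransportMatching` (the labelled-permutation model: `Config n = Perm (Fin (n+1)) × (Fin (n+1) → Bool)`,
`badSet`, `AllBad`, `AllBadOff`, `layer`, `remove`, the typed conjecture `TransportMatching n`) — whose docstring, like those of `…RuleT`,
`…CBar` and `…SideCriterion`, had to say "by the complement form of `Φ` (memo (I5), NOT formalised) this is a bijective proof of (B)".
This file formalises that link.

* LABEL EXPANSION (`prod_one_sub_mix_eq_sum_labels`): for nonempty pairwise disjoint sets `c ∈ O`,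
  `∏_{c ∈ O} (w[c ∉ 𝒰] + (1−w)[c ∉ 𝒱]) = Σ_{λ : T → Bool} w^{#λ⁻¹false}(1−w)^{#λ⁻¹true}·[every c ∈ O is bad for the label of min c]`
  (points labelled independently, a set reads its label at its minimum as in `LabelTransport.setLabel`); hence
  `badPoly_mix_eq_sum_configs` (`A` = generating function of the all-bad configurations) and `capPoly_mix_eq_sum_configs`
  (`W^{(y)}` = that of the configurations all-bad OFF the fixed point `y`; permutations fixing `y` = `CycleForm.glue {y} 1 τ`).
* **`phiSet_mix_eq_sum_counts` (every pair of families, no hypothesis):**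
  `Φ_{n+1}(w·1_𝒰 + (1−w)·1_𝒱) = Σ_{s=0}^{n+1} (pointedCount s − allBadCount s)·w^{n+1−s}(1−w)^s`,
  `allBadCount s = #{(σ,λ) all-bad, s labels true}`, `pointedCount s = #{(y,σ,λ) : σ y = y, every other cycle bad, s labels true}` —
  the layer sums `N_s` of conjecture (B) ARE the differences of these two counts (memos P4-GEN24 §8, P4-GEN25 §1, P4-GEN26 §1).
* **`bpos_mix_of_counts` / `counts_le_of_bpos_mix`: conjecture (B) for a pair ⟺ `allBadCount s ≤ pointedCount s` for every layer `s`**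
  (⇐ by nonnegative monomials; ⇒ by uniqueness of the Bernstein representation, `UCBernsteinNested.bernstein_coeff_nonneg_of_bpos`).
* **`bpos_mix_of_transportMatching`: `TransportMatching n` ⇒ conjecture (B) for every pair of union-closed families `∋ univ` on
  `Fin (n+1)`** (a removal-with-transport injection at layer `s` is an injection all-bad_s ↪ pointed all-bad_s, `counts_le_of_injection`,
  `LabelTransport.layer_remove`).  So a proof of (TM) — RULE T (`RemovalInjection.removalMatching_of_unionClosed`) is its one-family case —
  now closes (B) for pairs INSIDE the kernel, with no further bookkeeping.
HONEST FRAMING: identities and a proved reduction; (TM), (B), `UCHullNonneg k` (k ≥ 8), Sahi's `C_k` and the master theorem remain OPEN.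
Axioms standard. [this work]
-/

noncomputable section

open scoped Classical

namespace Summit.CriticalPhenomena.PercolationContinuityZ3.Theorems

namespace ComplementForm

open Finset Function Equiv
open Literature.Combinatorics.Sahi2008
open Literature.Combinatorics.Sahi2008.CycleForm
open PrincipalCapBeta (phiSet realF realW)
open BernsteinPos LabelTransport

variable {n : ℕ}

/-! ### Label weights -/
/-- The weight of one point label: `w` for `false` (family `𝒰`), `1 − w` for `true` (family `𝒱`). [this work] -/
def wt (w : ℝ) (b : Bool) : ℝ := if b then 1 - w else w

/-- The weight of a point labelling: `w^{#false} (1−w)^{#true}`. [this work] -/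
def labWeight (w : ℝ) (lam : Fin (n + 1) → Bool) : ℝ := ∏ i, wt w (lam i)

/-- `labWeight w λ = w^{n+1−s} (1−w)^s`, `s` = the layer (number of `true` labels). [this work] -/
theorem labWeight_eq_pow (w : ℝ) (σ : Perm (Fin (n + 1))) (lam : Fin (n + 1) → Bool) :
    labWeight w lam = w ^ (n + 1 - layer (σ, lam)) * (1 - w) ^ layer (σ, lam) := by
  unfold labWeight layer wt
  rw [prod_ite, prod_const, prod_const, mul_comm]
  have hc : (univ.filter fun i : Fin (n + 1) => ¬ (lam i = true)).card = n + 1 - (univ.filter fun i : Fin (n + 1) => lam i = true).card := by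
    have h := Finset.card_filter_add_card_filter_not (s := (univ : Finset (Fin (n + 1)))) (fun i => lam i = true)
    rw [card_univ, Fintype.card_fin] at h
    omega
  simp only [hc]

/-! ### The label expansion of a product of bad-cycle weights -/

/-- The representative of a (nonempty) set: its minimum (junk `0` on `∅`); `setLabel λ c = λ (rep c)`. [this work] -/
def rep (c : Finset (Fin (n + 1))) : Fin (n + 1) := if h : c.Nonempty then c.min' h else 0

/-- `setLabel λ c = λ (rep c)` on nonempty sets. [this work] -/
theorem setLabel_eq_rep (lam : Fin (n + 1) → Bool) {c : Finset (Fin (n + 1))} (hc : c.Nonempty) :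
    setLabel lam c = lam (rep c) := by
  unfold setLabel rep; rw [dif_pos hc, dif_pos hc]

/-- The representative lies in the set. [this work] -/
theorem rep_mem {c : Finset (Fin (n + 1))} (hc : c.Nonempty) : rep c ∈ c := by
  unfold rep; rw [dif_pos hc]; exact min'_mem c hc

/-- **Label expansion.**  For a family `O` of nonempty, pairwise disjoint sets,
`∏_{c ∈ O} (w[c ∉ 𝒰] + (1−w)[c ∉ 𝒱]) = Σ_{λ : T → Bool} w^{#false}(1−w)^{#true} · [every c ∈ O is bad for the label of its minimum]`:
label the points independently, read each set's label at its minimum; points that are nobody's minimum contribute `w + (1−w) = 1`. [this work] -/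
theorem prod_one_sub_mix_eq_sum_labels (𝒰 𝒱 : Finset (Finset (Fin (n + 1)))) (w : ℝ) (O : Finset (Finset (Fin (n + 1))))
    (hne : ∀ c ∈ O, c.Nonempty) (hdisj : ∀ c₁ ∈ O, ∀ c₂ ∈ O, ∀ x, x ∈ c₁ → x ∈ c₂ → c₁ = c₂) :
    ∏ c ∈ O, (1 - mix 𝒰 𝒱 w c) =
      ∑ lam : Fin (n + 1) → Bool, labWeight w lam * ∏ c ∈ O, (if badSet 𝒰 𝒱 lam c then (1 : ℝ) else 0) := by
  -- injectivity of `rep` on `O`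
  have hinj : ∀ c₁ ∈ O, ∀ c₂ ∈ O, rep c₁ = rep c₂ → c₁ = c₂ := fun c₁ h₁ c₂ h₂ h =>
    hdisj c₁ h₁ c₂ h₂ (rep c₁) (rep_mem (hne c₁ h₁)) (h ▸ rep_mem (hne c₂ h₂))
  -- the factorised integrand
  let G : Fin (n + 1) → Bool → ℝ := fun i b =>
    wt w b * ∏ c ∈ O.filter (fun c => rep c = i), (if c ∉ famOf 𝒰 𝒱 b then (1 : ℝ) else 0)
  have hint : ∀ lam : Fin (n + 1) → Bool,
      labWeight w lam * ∏ c ∈ O, (if badSet 𝒰 𝒱 lam c then (1 : ℝ) else 0) = ∏ i, G i (lam i) := by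
    intro lam
    unfold labWeight
    rw [prod_mul_distrib]
    congr 1
    rw [← prod_fiberwise_of_maps_to (s := O) (t := (univ : Finset (Fin (n + 1)))) (g := rep) (fun _ _ => mem_univ _)]
    refine prod_congr rfl fun i _ => prod_congr rfl fun c hc => ?_
    obtain ⟨hcO, hci⟩ := mem_filter.1 hc
    have e : badSet 𝒰 𝒱 lam c ↔ c ∉ famOf 𝒰 𝒱 (lam i) := by
      unfold badSet; rw [setLabel_eq_rep lam (hne c hcO), hci]
    by_cases hb : c ∉ famOf 𝒰 𝒱 (lam i)
    · rw [if_pos (e.2 hb), if_pos hb]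
    · rw [if_neg (fun h => hb (e.1 h)), if_neg hb]
  rw [sum_congr rfl fun lam _ => hint lam, ← Fintype.piFinset_univ, ← prod_univ_sum (fun _ => (univ : Finset Bool)) G]
  -- each factor: `1 − mix` at a representative, `1` elsewhere
  have hH : ∀ i, ∑ b ∈ (univ : Finset Bool), G i b = if h : ∃ c ∈ O, rep c = i then 1 - mix 𝒰 𝒱 w (Classical.choose h) else 1 := by
    intro i
    rw [Fintype.sum_bool]
    by_cases h : ∃ c ∈ O, rep c = i
    · rw [dif_pos h]
      obtain ⟨hc₀, hrep⟩ := Classical.choose_spec h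
      set c₀ := Classical.choose h
      have hfil : O.filter (fun c => rep c = i) = {c₀} := by
        ext c
        simp only [mem_filter, mem_singleton]
        constructor
        · rintro ⟨hc, hci⟩; exact hinj c hc c₀ hc₀ (hci.trans hrep.symm)
        · rintro rfl; exact ⟨hc₀, hrep⟩
      simp only [G, hfil, prod_singleton, wt, one_sub_mix]
      simp only [if_true, if_false, Bool.false_eq_true]
      unfold famOf
      simp only [if_true, if_false, Bool.false_eq_true]
      split_ifs <;> ring
    · rw [dif_neg h]
      have hfil : O.filter (fun c => rep c = i) = ∅ := by
        ext c
        simp only [mem_filter, notMem_empty, iff_false, not_and]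
        exact fun hc hci => h ⟨c, hc, hci⟩
      simp only [G, hfil, prod_empty, mul_one, wt, if_true, if_false, Bool.false_eq_true]
      ring
  simp only [hH]
  -- product over the image of `rep`
  rw [← prod_subset (subset_univ (O.image rep)) (fun i _ hi => by
        rw [dif_neg (fun ⟨c, hc, hci⟩ => hi (mem_image.2 ⟨c, hc, hci⟩))]),
    prod_image fun c₁ h₁ c₂ h₂ h => hinj c₁ h₁ c₂ h₂ h]
  refine prod_congr rfl fun c hc => ?_
  have h : ∃ c' ∈ O, rep c' = rep c := ⟨c, hc, rfl⟩
  rw [dif_pos h]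
  obtain ⟨hc', hrep⟩ := Classical.choose_spec h
  rw [hinj _ hc' _ hc hrep]

/-! ### All-bad configurations: `A(w)` -/
/-- The orbits of a permutation are nonempty. [folklore] -/
theorem orbits_nonempty (σ : Perm (Fin (n + 1))) : ∀ c ∈ orbits σ, c.Nonempty := by
  intro c hc
  unfold orbits at hc
  obtain ⟨i, _, rfl⟩ := mem_image.1 hc
  exact ⟨i, self_mem_orbit σ i⟩

/-- Distinct orbits are disjoint. [folklore] -/
theorem orbits_disjoint (σ : Perm (Fin (n + 1))) :
    ∀ c₁ ∈ orbits σ, ∀ c₂ ∈ orbits σ, ∀ x, x ∈ c₁ → x ∈ c₂ → c₁ = c₂ := by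
  intro c₁ h₁ c₂ h₂ x hx₁ hx₂
  unfold orbits at h₁ h₂
  obtain ⟨i, _, rfl⟩ := mem_image.1 h₁
  obtain ⟨j, _, rfl⟩ := mem_image.1 h₂
  rw [orbit_eq_orbit_of_sameCycle (mem_orbit.1 hx₁), orbit_eq_orbit_of_sameCycle (mem_orbit.1 hx₂)]

/-- `AllBad` is badness of every orbit. [this work] -/
theorem allBad_iff (𝒰 𝒱 : Finset (Finset (Fin (n + 1)))) (c : Config n) :
    AllBad 𝒰 𝒱 c ↔ ∀ O ∈ orbits c.1, badSet 𝒰 𝒱 c.2 O := by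
  unfold AllBad orbits
  constructor
  · intro h O hO
    obtain ⟨i, _, rfl⟩ := mem_image.1 hO
    exact h i
  · intro h i
    exact h _ (mem_image.2 ⟨i, mem_univ _, rfl⟩)

/-- **The all-bad polynomial is the generating function of the all-bad configurations**:
`A(w·1_𝒰 + (1−w)·1_𝒱) = Σ_{(σ,λ) all-bad} w^{#false}(1−w)^{#true}`. [this work] -/
theorem badPoly_mix_eq_sum_configs (𝒰 𝒱 : Finset (Finset (Fin (n + 1)))) (w : ℝ) :
    badPoly (mix 𝒰 𝒱 w) = ∑ c : Config n, (if AllBad 𝒰 𝒱 c then labWeight w c.2 else 0) := by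
  unfold badPoly
  rw [Fintype.sum_prod_type]
  refine sum_congr rfl fun σ _ => ?_
  rw [prod_one_sub_mix_eq_sum_labels 𝒰 𝒱 w (orbits σ) (orbits_nonempty σ) (orbits_disjoint σ)]
  refine sum_congr rfl fun lam _ => ?_
  rw [prod_boole]
  by_cases h : AllBad 𝒰 𝒱 (σ, lam)
  · rw [if_pos ((allBad_iff 𝒰 𝒱 (σ, lam)).1 h), if_pos h, mul_one]
  · rw [if_neg (fun h' => h ((allBad_iff 𝒰 𝒱 (σ, lam)).2 h')), if_neg h, mul_zero]

/-! ### Pointed all-bad configurations: `W^{(y)}(w)` -/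
/-- The orbit of a fixed point is the singleton. [folklore] -/
theorem orbit_eq_singleton_of_fix {σ : Perm (Fin (n + 1))} {y : Fin (n + 1)} (hy : σ y = y) : orbit σ y = {y} := by
  ext x
  rw [mem_orbit, mem_singleton]
  refine ⟨fun ⟨k, hk⟩ => ?_, fun h => h ▸ Equiv.Perm.SameCycle.refl _ _⟩
  rw [Equiv.Perm.zpow_apply_eq_self_of_apply_eq_self hy] at hk
  exact hk.symm

/-- `AllBadOff y` for a configuration fixing `y` is badness of every orbit other than `{y}`. [this work] -/
theorem allBadOff_iff (𝒰 𝒱 : Finset (Finset (Fin (n + 1)))) (y : Fin (n + 1)) (c : Config n) (hy : c.1 y = y) :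
    AllBadOff 𝒰 𝒱 y c ↔ ∀ O ∈ (orbits c.1).erase {y}, badSet 𝒰 𝒱 c.2 O := by
  unfold AllBadOff
  constructor
  · rintro ⟨_, h⟩ O hO
    obtain ⟨hOy, hO⟩ := mem_erase.1 hO
    unfold orbits at hO
    obtain ⟨i, _, rfl⟩ := mem_image.1 hO
    refine h i fun hiy => hOy ?_
    rw [hiy, orbit_eq_singleton_of_fix hy]
  · intro h
    refine ⟨hy, fun i hi => h _ (mem_erase.2 ⟨fun hO => hi ?_, orbit_mem_orbits _ _⟩)⟩
    have : i ∈ orbit c.1 i := self_mem_orbit _ _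
    rw [hO, mem_singleton] at this
    exact this

/-- No orbit of a permutation of the complement of `{y}` pushes forward to `{y}`. [folklore] -/
theorem singleton_notMem_image_orbits (y : Fin (n + 1)) (τ : Perm {x // x ∉ ({y} : Finset (Fin (n + 1)))}) :
    ({y} : Finset (Fin (n + 1))) ∉ (orbits τ).image (Finset.map (Embedding.subtype _)) := by
  intro h
  obtain ⟨O', hO', hO'B⟩ := mem_image.1 h
  unfold orbits at hO'
  obtain ⟨z, -, rfl⟩ := mem_image.1 hO'
  have hz : (z : Fin (n + 1)) ∈ (orbit τ z).map (Embedding.subtype _) := mem_map.2 ⟨z, self_mem_orbit τ z, rfl⟩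
  rw [hO'B] at hz
  exact z.2 hz

/-- The cap polynomial at `y` as a sum over the permutations FIXING `y` of the bad-cycle weights of the other cycles. [this work] -/
theorem capPoly_eq_sum_fix (β : Finset (Fin (n + 1)) → ℝ) (y : Fin (n + 1)) :
    capPoly y β = ∑ σ ∈ univ.filter (fun σ : Perm (Fin (n + 1)) => σ y = y), ∏ c ∈ (orbits σ).erase {y}, (1 - β c) := by
  -- left: permutations of the punctured type `{x // x ∉ {y}}`
  rw [← badSum_realW_ne, badSum_subtype_congr (realW β) realF (p := fun x => x ≠ y) (q := fun x => x ∉ ({y} : Finset (Fin (n + 1))))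
    (fun x => by simp)]
  -- right: glue the one-point cycle on `{y}` with a permutation of the complement
  have hperm : univ.filter (fun σ : Perm (Fin (n + 1)) => σ y = y) = permsContaining {y} (1 : Perm {x // x ∈ ({y} : Finset (Fin (n + 1)))}) := by
    ext σ
    rw [mem_filter, mem_permsContaining]
    simp only [mem_univ, true_and, Perm.one_apply]
    constructor
    · intro h x; have hx : (x : Fin (n + 1)) = y := mem_singleton.1 x.2; rw [hx, h]
    · intro h; exact h ⟨y, mem_singleton_self y⟩
  have hcB : ∀ a b : {x // x ∈ ({y} : Finset (Fin (n + 1)))},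
      Equiv.Perm.SameCycle (1 : Perm {x // x ∈ ({y} : Finset (Fin (n + 1)))}) a b := by
    intro a b
    have : a = b := Subtype.ext ((mem_singleton.1 a.2).trans (mem_singleton.1 b.2).symm)
    rw [this]
  rw [hperm, permsContaining_eq_image, sum_image fun τ₁ _ τ₂ _ h => glue_injective _ h]
  unfold badSum
  beta_reduce
  refine sum_congr rfl fun τ _ => ?_
  rw [orbits_glue hcB τ ⟨y, mem_singleton_self y⟩, erase_insert (singleton_notMem_image_orbits y τ),
    prod_image fun O₁ _ O₂ _ h => map_injective _ h]
  refine prod_congr rfl fun O _ => ?_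
  rw [ex_prod_subtype (realW β) realF (fun x => x ∉ ({y} : Finset (Fin (n + 1)))) O, ex_realW_prod_fun]

/-- **The cap polynomial at `y` is the generating function of the configurations that are all-bad off the fixed point `y`**
(the label of `y` is free: its weight `w + (1−w) = 1`). [this work] -/
theorem capPoly_mix_eq_sum_configs (𝒰 𝒱 : Finset (Finset (Fin (n + 1)))) (w : ℝ) (y : Fin (n + 1)) :
    capPoly y (mix 𝒰 𝒱 w) = ∑ c : Config n, (if AllBadOff 𝒰 𝒱 y c then labWeight w c.2 else 0) := by
  rw [capPoly_eq_sum_fix, Fintype.sum_prod_type, ← sum_filter_add_sum_filter_not univ (fun σ : Perm (Fin (n + 1)) => σ y = y)]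
  have h0 : ∑ σ ∈ univ.filter (fun σ : Perm (Fin (n + 1)) => ¬ σ y = y),
      ∑ lam : Fin (n + 1) → Bool, (if AllBadOff 𝒰 𝒱 y (σ, lam) then labWeight w lam else 0) = 0 := by
    refine sum_eq_zero fun σ hσ => sum_eq_zero fun lam _ => ?_
    rw [if_neg (fun h => (mem_filter.1 hσ).2 h.1)]
  rw [h0, add_zero]
  refine sum_congr rfl fun σ hσ => ?_
  have hy : σ y = y := (mem_filter.1 hσ).2
  rw [prod_one_sub_mix_eq_sum_labels 𝒰 𝒱 w ((orbits σ).erase {y}) (fun c hc => orbits_nonempty σ c (mem_of_mem_erase hc))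
    (fun c₁ h₁ c₂ h₂ => orbits_disjoint σ c₁ (mem_of_mem_erase h₁) c₂ (mem_of_mem_erase h₂))]
  refine sum_congr rfl fun lam _ => ?_
  rw [prod_boole]
  by_cases h : AllBadOff 𝒰 𝒱 y (σ, lam)
  · rw [if_pos ((allBadOff_iff 𝒰 𝒱 y (σ, lam) hy).1 h), if_pos h, mul_one]
  · rw [if_neg (fun h' => h ((allBadOff_iff 𝒰 𝒱 y (σ, lam) hy).2 h')), if_neg h, mul_zero]

/-! ### The edge polynomial counts, layer by layer -/
/-- **THE COUNTING FORM OF THE EDGE POLYNOMIAL** (every pair of families, no hypothesis):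
`Φ_{n+1}(w·1_𝒰 + (1−w)·1_𝒱) = Σ_{(y,σ,λ) all-bad off the fixed point y} w^{#false}(1−w)^{#true} − Σ_{(σ,λ) all-bad} w^{#false}(1−w)^{#true}`.
[this work] -/
theorem phiSet_mix_eq_pointed_sub_allBad (𝒰 𝒱 : Finset (Finset (Fin (n + 1)))) (w : ℝ) :
    phiSet (n + 1) (mix 𝒰 𝒱 w) =
      (∑ y : Fin (n + 1), ∑ c : Config n, (if AllBadOff 𝒰 𝒱 y c then labWeight w c.2 else 0)) -
        ∑ c : Config n, (if AllBad 𝒰 𝒱 c then labWeight w c.2 else 0) := by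
  rw [phiSet_eq_sum_capPoly_sub_badPoly, badPoly_mix_eq_sum_configs]
  simp only [capPoly_mix_eq_sum_configs]

/-- The number of all-bad configurations of layer `s`. [this work] -/
def allBadCount (𝒰 𝒱 : Finset (Finset (Fin (n + 1)))) (s : ℕ) : ℕ :=
  ((univ : Finset (Config n)).filter fun c => AllBad 𝒰 𝒱 c ∧ layer c = s).card

/-- The number of pointed all-bad configurations `(y, c)` (`c` all-bad off its fixed point `y`) of layer `s`. [this work] -/
def pointedCount (𝒰 𝒱 : Finset (Finset (Fin (n + 1)))) (s : ℕ) : ℕ :=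
  ((univ : Finset (Fin (n + 1) × Config n)).filter fun p => AllBadOff 𝒰 𝒱 p.1 p.2 ∧ layer p.2 = s).card

/-- Grouping a weighted count of configurations by layer. [this work] -/
theorem sum_configs_by_layer (w : ℝ) (P : Config n → Prop) :
    ∑ c : Config n, (if P c then labWeight w c.2 else 0) =
      ∑ s ∈ range (n + 2), (((univ : Finset (Config n)).filter fun c => P c ∧ layer c = s).card : ℝ) *
        (w ^ (n + 1 - s) * (1 - w) ^ s) := by
  have hmaps : ∀ c ∈ (univ : Finset (Config n)).filter P, layer c ∈ range (n + 2) := by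
    intro c _
    rw [mem_range]
    have : layer c ≤ n + 1 := by
      unfold layer
      exact (card_filter_le _ _).trans (by rw [card_univ, Fintype.card_fin])
    omega
  rw [← sum_filter, ← sum_fiberwise_of_maps_to hmaps]
  refine sum_congr rfl fun s _ => ?_
  rw [filter_filter]
  have e : ∀ c ∈ (univ : Finset (Config n)).filter (fun c => P c ∧ layer c = s),
      labWeight w c.2 = w ^ (n + 1 - s) * (1 - w) ^ s := by
    intro c hc
    obtain ⟨_, hs⟩ := (mem_filter.1 hc).2
    rw [labWeight_eq_pow w c.1, ← hs]
  rw [sum_congr rfl e, sum_const, nsmul_eq_mul]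

/-- Grouping the pointed count by layer. [this work] -/
theorem sum_pointed_by_layer (𝒰 𝒱 : Finset (Finset (Fin (n + 1)))) (w : ℝ) :
    ∑ y : Fin (n + 1), ∑ c : Config n, (if AllBadOff 𝒰 𝒱 y c then labWeight w c.2 else 0) =
      ∑ s ∈ range (n + 2), (pointedCount 𝒰 𝒱 s : ℝ) * (w ^ (n + 1 - s) * (1 - w) ^ s) := by
  unfold pointedCount
  have hmaps : ∀ p ∈ (univ : Finset (Fin (n + 1) × Config n)).filter (fun p => AllBadOff 𝒰 𝒱 p.1 p.2), layer p.2 ∈ range (n + 2) := by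
    intro p _
    rw [mem_range]
    have : layer p.2 ≤ n + 1 := by
      unfold layer
      exact (card_filter_le _ _).trans (by rw [card_univ, Fintype.card_fin])
    omega
  rw [← Fintype.sum_prod_type', ← sum_filter, ← sum_fiberwise_of_maps_to hmaps]
  refine sum_congr rfl fun s _ => ?_
  rw [filter_filter]
  have e : ∀ p ∈ (univ : Finset (Fin (n + 1) × Config n)).filter (fun p => AllBadOff 𝒰 𝒱 p.1 p.2 ∧ layer p.2 = s),
      labWeight w p.2.2 = w ^ (n + 1 - s) * (1 - w) ^ s := by
    intro p hp
    obtain ⟨_, hs⟩ := (mem_filter.1 hp).2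
    rw [labWeight_eq_pow w p.2.1, ← hs]
  rw [sum_congr rfl e, sum_const, nsmul_eq_mul]

/-- **THE LAYERED COUNT IDENTITY**: for every pair of families,
`Φ_{n+1}(w·1_𝒰 + (1−w)·1_𝒱) = Σ_{s=0}^{n+1} (#pointed all-bad of layer s − #all-bad of layer s) · w^{n+1−s}(1−w)^s` —
the degree-`(n+1)` Bernstein coefficients of the edge polynomial (the layer sums `N_s` of conjecture (B)) are differences of two counts. [this work] -/
theorem phiSet_mix_eq_sum_counts (𝒰 𝒱 : Finset (Finset (Fin (n + 1)))) (w : ℝ) :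
    phiSet (n + 1) (mix 𝒰 𝒱 w) =
      ∑ s ∈ range (n + 2), (((pointedCount 𝒰 𝒱 s : ℝ) - allBadCount 𝒰 𝒱 s) * (w ^ (n + 1 - s) * (1 - w) ^ s)) := by
  rw [phiSet_mix_eq_pointed_sub_allBad, sum_pointed_by_layer, sum_configs_by_layer w (AllBad 𝒰 𝒱), ← sum_sub_distrib]
  unfold allBadCount
  exact sum_congr rfl fun s _ => by ring

/-- **Counting criterion ⇒ (B) for the pair**: if at every layer the all-bad configurations are at most as many as the pointed all-bad
configurations, the edge polynomial is Bernstein-positive of degree `n+1` — for ANY two families. [this work] -/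
theorem bpos_mix_of_counts (𝒰 𝒱 : Finset (Finset (Fin (n + 1)))) (h : ∀ s ≤ n + 1, allBadCount 𝒰 𝒱 s ≤ pointedCount 𝒰 𝒱 s) :
    BPos (n + 1) (fun w => phiSet (n + 1) (mix 𝒰 𝒱 w)) := by
  refine (BPos.sum (range (n + 2)) (fun s w => (((pointedCount 𝒰 𝒱 s : ℝ) - allBadCount 𝒰 𝒱 s) *
    (w ^ (n + 1 - s) * (1 - w) ^ s))) fun s hs => ?_).congr fun w => (phiSet_mix_eq_sum_counts 𝒰 𝒱 w).symm
  have hs' : s ≤ n + 1 := by have := mem_range.1 hs; omega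
  refine bpos_monomial ?_ (n + 1 - s) s (by omega)
  have := h s hs'
  exact_mod_cast sub_nonneg.2 (show (allBadCount 𝒰 𝒱 s : ℝ) ≤ pointedCount 𝒰 𝒱 s by exact_mod_cast this)

/-- **(B) for the pair ⇒ the counting criterion** (uniqueness of the degree-`(n+1)` Bernstein representation,
`UCBernsteinNested.bernstein_coeff_nonneg_of_bpos`): conjecture (B) for a pair IS the layerwise count inequality. [this work] -/
theorem counts_le_of_bpos_mix (𝒰 𝒱 : Finset (Finset (Fin (n + 1)))) (h : BPos (n + 1) (fun w => phiSet (n + 1) (mix 𝒰 𝒱 w))) :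
    ∀ s ≤ n + 1, allBadCount 𝒰 𝒱 s ≤ pointedCount 𝒰 𝒱 s := by
  intro s hs
  have key := UCBernsteinNested.bernstein_coeff_nonneg_of_bpos h (fun s => (pointedCount 𝒰 𝒱 s : ℝ) - allBadCount 𝒰 𝒱 s)
    (fun w => phiSet_mix_eq_sum_counts 𝒰 𝒱 w) s hs
  exact_mod_cast sub_nonneg.1 key

/-! ### (TM) ⇒ (B) -/
/-- **A removal injection at layer `s` gives the count inequality at layer `s`**: if `f` assigns to every all-bad configuration of layer `s`
a point whose transport-removal is all-bad off it, injectively, then `#all-bad_s ≤ #pointed all-bad_s`. [this work] -/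
theorem counts_le_of_injection (𝒰 𝒱 : Finset (Finset (Fin (n + 1)))) (s : ℕ) (f : Config n → Fin (n + 1))
    (hf : ∀ c, AllBad 𝒰 𝒱 c → layer c = s → AllBadOff 𝒰 𝒱 (f c) (remove (f c) c))
    (hinj : ∀ c₁ c₂, AllBad 𝒰 𝒱 c₁ → AllBad 𝒰 𝒱 c₂ → layer c₁ = s → layer c₂ = s →
      f c₁ = f c₂ → remove (f c₁) c₁ = remove (f c₂) c₂ → c₁ = c₂) :
    allBadCount 𝒰 𝒱 s ≤ pointedCount 𝒰 𝒱 s := by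
  unfold allBadCount pointedCount
  refine card_le_card_of_injOn (fun c => (f c, remove (f c) c)) (fun c hc => ?_) (fun c₁ h₁ c₂ h₂ h => ?_)
  · obtain ⟨hc, hs⟩ := (mem_filter.1 (mem_coe.1 hc)).2
    exact mem_coe.2 (mem_filter.2 ⟨mem_univ _, hf c hc hs, by rw [layer_remove]; exact hs⟩)
  · obtain ⟨hc₁, hs₁⟩ := (mem_filter.1 (mem_coe.1 h₁)).2
    obtain ⟨hc₂, hs₂⟩ := (mem_filter.1 (mem_coe.1 h₂)).2
    have h' := Prod.mk.inj h
    exact hinj c₁ c₂ hc₁ hc₂ hs₁ hs₂ h'.1 h'.2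

/-- **THEOREM ((TM) ⇒ (B), every order).**  The typed transport-matching conjecture `LabelTransport.TransportMatching n` implies conjecture (B)
for every pair of union-closed families of subsets of `Fin (n+1)` containing `univ`: the edge polynomial `w ↦ Φ_{n+1}(w·1_𝒰 + (1−w)·1_𝒱)`
is Bernstein-positive of degree `n+1`. [this work] -/
theorem bpos_mix_of_transportMatching (hTM : TransportMatching n) (𝒰 𝒱 : Finset (Finset (Fin (n + 1))))
    (hU : ∀ A ∈ 𝒰, ∀ B ∈ 𝒰, A ∪ B ∈ 𝒰) (hV : ∀ A ∈ 𝒱, ∀ B ∈ 𝒱, A ∪ B ∈ 𝒱) (htU : univ ∈ 𝒰) (htV : univ ∈ 𝒱) :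
    BPos (n + 1) (fun w => phiSet (n + 1) (mix 𝒰 𝒱 w)) := by
  refine bpos_mix_of_counts 𝒰 𝒱 fun s _ => ?_
  obtain ⟨f, hf, hinj⟩ := hTM 𝒰 𝒱 hU hV htU htV s
  exact counts_le_of_injection 𝒰 𝒱 s f hf hinj

end ComplementForm

end Summit.CriticalPhenomena.PercolationContinuityZ3.Theorems
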